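import Summits.QuantumFields.YangMills.Theorems.DiagonalMirrorRPRWilsonDiagonalModelChainResum
import Summits.QuantumFields.YangMills.Theorems.DiagonalMirrorRPRWilsonDiagonalModelPairChain
import Summits.QuantumFields.YangMills.Theorems.DiagonalMirrorRPRWilsonDiagonalModelNatKernelL2

/-!
# Crux `DiagonalMirrorRPR` (stmt-QuantumFields-10604), line `sign-twisted-diagonal-trace`, construction F1_diag
# (director-ym O4 WORD 3 (A)), S4d (first half): the cyclic `K_u` trace as an integral of a SUM over feature multi-indices

Helper for the crux `DiagonalMirrorRPR` of `YangMills` (routes `IsotropyFromPowerCounting`, `MirrorModularBoosts`,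
`PencilRigidity`; item stmt-QuantumFields-10604), attached `--supports … --as helper`; it closes nothing by itself.
Continuation of `…ChainResum` (`hasSum_chainIntegrand`) and `…PairChain` (`diagCyclicTraceU_eq_integral_pairs`).

* `chainFactor ρ β k P t = e^{β inslab X_t} ψ_{k_t}(w(ΘY_{t+1})) ψ_{k_t}(w(Y_t)) e^{β odd(X_t, Y_{t+1}, X_{t+1})}` (the `t`-th factor of the
  resummed chain; after the `Y`-integrations these are the factors of the lifted kernel `𝔞`), `continuous_chainFactor`;
* `hasSum_prod_chainFactor` (the `K_u` pair-chain integrand is `Σ_{k ∈ ℕ^{ℤ_m}} ∏_t chainFactor k P t`);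
* ★ **`diagCyclicTraceU_eq_integral_tsum`**: `diagCyclicTraceU ρ β m = ∫ Σ'_{k} ∏_t chainFactor ρ β k P t dP` over `(halfHaar ⊗ halfHaar)^{ℤ_m}`.

OWED (S4d second half): the interchange `∫ Σ' = Σ' ∫` (absolute convergence: `Σ'_k ∏|chainFactor|` is bounded) and the `Y`-integrations
(Fubini) producing `Σ'_{k} ∫_X ∏_t 𝔞((k_t, X_t), (k_{t+1}, X_{t+1}))`, i.e. the cyclic `m`-fold integral of `natKernel ρ β` over
`(count ⊗ halfHaar)^m`; then the spectral side (S4e).  HONEST FRAMING: construction helper; no `def wilsonDiagonalModel`; nothing about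
D_old ⟨10604⟩, the RP crux of the FOLD restate, or the summit is proved; the Yang–Mills mass gap is NOT proved here or anywhere in the tree.
-/

set_option autoImplicit false

noncomputable section

open scoped BigOperators
open MeasureTheory
open Literature.MathematicalPhysics.QuantumLattice Literature.MathematicalPhysics.QuantumFieldTheory
open Summit.QuantumFields.YangMills.Cruxes.DiagonalMirrorRPR.ParityBridgeColdTraces

namespace Summit.QuantumFields.YangMills.Cruxes.DiagonalMirrorRPR.SignTwistedDiagonalTrace.WilsonDiagonal

/-! ## §25 The chain as a sum over feature multi-indices -/

section ChainTonelli

variable {S : ℕ} [NeZero S] {G : Type} [Group G] {Nc : ℕ} (ρ : G →* Matrix (Fin Nc) (Fin Nc) ℂ)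
variable [TopologicalSpace G] [IsTopologicalGroup G] [CompactSpace G] [MeasurableSpace G] [BorelSpace G]
  [SecondCountableTopology G]

/-- The `t`-th factor of the resummed chain integrand for the multi-index `k`: 
`e^{β inslab X_t} ψ_{k_t}(w(ΘY_{t+1})) ψ_{k_t}(w(Y_t)) e^{β odd(X_t, Y_{t+1}, X_{t+1})}`. -/
def chainFactor (β : ℝ) {m : ℕ} (k : ZMod m → ℕ) (P : ZMod m → HalfCfg S S G × HalfCfg S S G) (t : ZMod m) : ℝ :=
  Real.exp (β * inslabAction ρ (P t).2) *
    (natFeature (p := featDim S Nc) β (k t) (bondVec ρ (thetaHalf (P (t + 1)).1)) *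
      natFeature (p := featDim S Nc) β (k t) (bondVec ρ (P t).1)) *
    Real.exp (β * oddActionU ρ (P t).2 (P (t + 1)).1 (P (t + 1)).2)

omit [CompactSpace G] [MeasurableSpace G] [BorelSpace G] [SecondCountableTopology G] in
/-- Each chain factor is a continuous function of the chain configuration. -/
theorem continuous_chainFactor (hρ : Continuous ρ) (β : ℝ) {m : ℕ} (k : ZMod m → ℕ) (t : ZMod m) :
    Continuous fun P : ZMod m → HalfCfg S S G × HalfCfg S S G => chainFactor ρ β k P t := by
  unfold chainFactor
  have hins' : Continuous fun X : HalfCfg S S G => Real.exp (β * inslabAction ρ X) := by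
    refine Real.continuous_exp.comp (continuous_const.mul ?_)
    unfold inslabAction
    refine continuous_finsetSum _ fun s _ => Complex.continuous_re.comp (Continuous.matrix_trace (hρ.comp ?_))
    fun_prop
  have hP1 : ∀ s : ZMod m, Continuous fun P : ZMod m → HalfCfg S S G × HalfCfg S S G => (P s).1 := fun s =>
    continuous_fst.comp (continuous_apply s)
  have hP2 : ∀ s : ZMod m, Continuous fun P : ZMod m → HalfCfg S S G × HalfCfg S S G => (P s).2 := fun s =>
    continuous_snd.comp (continuous_apply s)
  have h3 : Continuous fun P : ZMod m → HalfCfg S S G × HalfCfg S S G => ((P t).2, (P (t + 1)).1, (P (t + 1)).2) :=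
    (hP2 t).prodMk ((hP1 (t + 1)).prodMk (hP2 (t + 1)))
  have hodd : Continuous fun P : ZMod m → HalfCfg S S G × HalfCfg S S G =>
      Real.exp (β * oddActionU ρ (P t).2 (P (t + 1)).1 (P (t + 1)).2) := by
    have h := (continuous_oddActionU ρ hρ).comp h3
    exact Real.continuous_exp.comp (continuous_const.mul (by simpa only [Function.comp_def] using h))
  have hA : Continuous fun P : ZMod m → HalfCfg S S G × HalfCfg S S G =>
      natFeature (p := featDim S Nc) β (k t) (bondVec ρ (thetaHalf (P (t + 1)).1)) := by
    have h := (continuous_natFeature_bondVec ρ hρ β (k t)).comp (continuous_thetaHalf.comp (hP1 (t + 1)))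
    simpa only [Function.comp_def] using h
  have hB : Continuous fun P : ZMod m → HalfCfg S S G × HalfCfg S S G =>
      natFeature (p := featDim S Nc) β (k t) (bondVec ρ (P t).1) := by
    have h := (continuous_natFeature_bondVec ρ hρ β (k t)).comp (hP1 t)
    simpa only [Function.comp_def] using h
  have hI : Continuous fun P : ZMod m → HalfCfg S S G × HalfCfg S S G => Real.exp (β * inslabAction ρ (P t).2) := by
    have h := hins'.comp (hP2 t)
    simpa only [Function.comp_def] using h
  exact (hI.mul (hA.mul hB)).mul hodd

omit [TopologicalSpace G] [IsTopologicalGroup G] [CompactSpace G] [MeasurableSpace G] [BorelSpace G]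
  [SecondCountableTopology G] in
/-- ★ **The `K_u` chain integrand is the sum over feature multi-indices of the chain factors** (pointwise, `β ≥ 0`, unitary `ρ`). -/
theorem hasSum_prod_chainFactor {β : ℝ} (hβ : 0 ≤ β) (hρu : ∀ g, ρ g ∈ Matrix.unitaryGroup (Fin Nc) ℂ) {m : ℕ} [NeZero m]
    (P : ZMod m → HalfCfg S S G × HalfCfg S S G) :
    HasSum (fun k : ZMod m → ℕ => ∏ t, chainFactor ρ β k P t)
      (∏ t : ZMod m, Real.exp (β * evenActionU ρ (P t).1 (P t).2 (P (t + 1)).1) *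
        Real.exp (β * oddActionU ρ (P t).2 (P (t + 1)).1 (P (t + 1)).2)) := by
  classical
  exact hasSum_chainIntegrand ρ hβ hρu (ι := ZMod m) (fun t => t + 1) (fun t => (P t).1) (fun t => (P t).2)

omit [SecondCountableTopology G] in
/-- ★ **The cyclic `K_u` trace as a pointwise sum**: `diagCyclicTraceU ρ β m = ∫ Σ'_{k ∈ ℕ^{ℤ_m}} ∏_t chainFactor k P t dP`. -/
theorem diagCyclicTraceU_eq_integral_tsum {β : ℝ} (hβ : 0 ≤ β) (hρu : ∀ g, ρ g ∈ Matrix.unitaryGroup (Fin Nc) ℂ)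
    (m : ℕ) [NeZero m] :
    diagCyclicTraceU ρ β m (S := S) (G := G) =
      ∫ P : ZMod m → HalfCfg S S G × HalfCfg S S G, ∑' k : ZMod m → ℕ, ∏ t, chainFactor ρ β k P t
        ∂(Measure.pi fun _ : ZMod m => (halfHaar S G).prod (halfHaar S G)) := by
  rw [diagCyclicTraceU_eq_integral_pairs]
  refine integral_congr_ae (ae_of_all _ fun P => ?_)
  exact ((hasSum_prod_chainFactor ρ hβ hρu P).tsum_eq).symm

end ChainTonelli

end Summit.QuantumFields.YangMills.Cruxes.DiagonalMirrorRPR.SignTwistedDiagonalTrace.WilsonDiagonal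

end
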